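import Mathlib
import Summits.Ventures.HodgeRepro.Tier4.Target
import Summits.Ventures.HodgeRepro.Tier4.Line4.AnisotropicLines

/-!
# Tier4/Line4/SylvesterLines — C-L4-LINE-PAIR: a `τ₀`-positive and a `τ₀`-negative `H`-orthogonal line of `V = E³` EXIST

Blind re-derivation cell `pub-hodge-repro`, Tier 4 «prove the step» (README §9–§10), seat t4-L1-p3 g5 (prover, LINE L1,
working the L4 cut by the lead's standing word; offer S16227).  Tree path `lean/Summits/Ventures/HodgeRepro/Tier4/Line4/SylvesterLines.lean`.
Mathlib-level; no literature; NO `def`, NO `instance`.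

WHAT IS PROVED (sorry-free, axioms `[propext, Classical.choice, Quot.sound]`; `c := (IsCMField.complexConj E).toRingEquiv`,
`⟪x, y⟫_H := hform c H x y`, `M := H.map τ₀`).
* `denseRange_complexEmbedding`: a complex embedding `τ₀` of the CM field `E` has DENSE image in `ℂ` (`E` is totally complex,
  so `τ₀` is not real: `ℚ + ℚ·τ₀(ω)` is dense for any `ω` with `τ₀ ω ∉ ℝ`); `denseRange_complexEmbedding_pi`: `τ₀(E)³` is dense in `ℂ³`.
* `map_hform`: `τ₀ ⟪x, y⟫_H = star (τ₀ ∘ x) ⬝ᵥ (M *ᵥ (τ₀ ∘ y))` (the two-argument form of SeesawCarry's `map_hform_self`);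
  `isHermitian_map_of_isCHermitian`: `M` is hermitian when `H` is `c`-hermitian; `hform_sub_smul`: `E`-linearity in the second slot.
* `exists_pos_of_isSylvester` / `exists_neg_of_isSylvester`: a Sylvester matrix `C` for `M` (`Cᴴ M C = ±J`, `J = diag(1,1,−1)`)
  exhibits a vector with `Re (star u ⬝ᵥ M u) > 0` and one with `< 0` (the columns `C e₀`, `C e₂`, swapped in the `−J` case).
* **`exists_orthogonal_lines_of_sylvester`** (THE CUT): from the target's own fields ALONE — `hH : IsCHermitian c H`, `τ₀`, `C`,
  `hC : IsSylvester (H.map τ₀) C` (Target.lean L240 / L243; TargetV3 L173 / L176) — there are `e₁ e₂ : Fin 3 → E` with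
  `e₁ ≠ 0`, `e₂ ≠ 0`, `⟪e₁, e₂⟫_H = 0`, `0 < Re τ₀⟪e₁, e₁⟫_H` and `Re τ₀⟪e₂, e₂⟫_H < 0`.  These are exactly the wall's `_ha` and
  `_hpos` at `i = 0, 2` (Skeleton v0.44 L2261) for the seesaw dictionary `a 0 = lineScalar hH e₁`, `a 2 = −lineScalar hH e₂`
  (SeesawScalars p716585 CONSUMES such a pair; this module PRODUCES one).  PROOF: the sign conditions are open in `ℂ³` and
  `τ₀(E)³` is dense, so a `τ₀`-positive `e₁ ∈ E³` exists near the positive Sylvester column; the `M`-orthogonal projection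
  `P y = y − (⟪x₁,y⟫/⟪x₁,x₁⟫) x₁` off `x₁ = τ₀ ∘ e₁` is continuous, maps `τ₀(E)³` into the `τ₀`-image of the `H`-orthogonal
  complement of `e₁` in `E³`, and its image contains a negative vector (else `Re φ ≥ 0` on `⟨x₁⟩ ⊕ x₁^⊥ = ℂ³`, against the negative
  Sylvester column — hermitian symmetry kills the cross terms); approximate that negative vector by `P (τ₀ ∘ f)`, `f ∈ E³`, and
  put `e₂ := f − (⟪e₁,f⟫/⟪e₁,e₁⟫) e₁`.

WHAT IT DOES NOT DO: nothing about WHICH lines the face picks (the bridge's face data (A3)/(B) stay the bridge's), nothing on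
`a 1, a 3`, `g`, `lam`, `_hiso` (the second plane), nothing at the costume; `mixed_classes_pair_v3` stays UNOWNED.
Nothing here says anything about the status of the Hodge conjecture for CM abelian varieties, which is NOT proved
(HC_CM is NOT proved by anyone in this repository).
-/

set_option autoImplicit false

noncomputable section

namespace Summit.Ventures.HodgeRepro.Tier4.Line4

open Summit.Ventures.HodgeRepro.Tier4 NumberField Matrix
open scoped ComplexConjugate

section Density

variable {E : Type} [Field E] [NumberField E] [IsCMField E]

/-- **A complex embedding of a CM field has dense image**: `E` is totally complex, so `τ₀` is not real; for `ω` with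
`τ₀ ω ∉ ℝ` the set `ℚ + ℚ·τ₀(ω) ⊆ τ₀(E)` is dense in `ℂ = ℝ + ℝ·τ₀(ω)`. -/
theorem denseRange_complexEmbedding (τ₀ : E →+* ℂ) : DenseRange τ₀ := by
  have hnr : ¬ ComplexEmbedding.IsReal τ₀ := IsTotallyComplex.complexEmbedding_not_isReal τ₀
  rw [ComplexEmbedding.isReal_iff] at hnr
  obtain ⟨ω, hω⟩ : ∃ ω : E, conj (τ₀ ω) ≠ τ₀ ω := by
    by_contra h
    exact hnr (RingHom.ext fun x => by
      rw [ComplexEmbedding.conjugate_coe_eq]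
      exact not_not.1 (not_exists.1 h x))
  have him : (τ₀ ω).im ≠ 0 := fun h0 => hω (Complex.conj_eq_iff_im.2 h0)
  -- the real parametrisation `(a, b) ↦ a + b·τ₀ ω` of `ℂ`
  have hgc : Continuous fun p : ℝ × ℝ => (p.1 : ℂ) + (p.2 : ℂ) * τ₀ ω := by fun_prop
  have hgs : Function.Surjective fun p : ℝ × ℝ => (p.1 : ℂ) + (p.2 : ℂ) * τ₀ ω := by
    intro w
    refine ⟨(w.re - (w.im / (τ₀ ω).im) * (τ₀ ω).re, w.im / (τ₀ ω).im), ?_⟩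
    apply Complex.ext
    · simp only [Complex.add_re, Complex.ofReal_re, Complex.mul_re, Complex.ofReal_im, zero_mul, sub_zero]
      ring
    · simp only [Complex.add_im, Complex.ofReal_im, Complex.mul_im, Complex.ofReal_re, zero_mul, zero_add,
        add_zero]
      field_simp
  have hq : DenseRange fun p : ℚ × ℚ => ((p.1 : ℝ), (p.2 : ℝ)) :=
    Rat.denseRange_cast.prodMap Rat.denseRange_cast
  have hgq : DenseRange ((fun p : ℝ × ℝ => (p.1 : ℂ) + (p.2 : ℂ) * τ₀ ω) ∘ fun p : ℚ × ℚ => ((p.1 : ℝ), (p.2 : ℝ))) :=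
    hgs.denseRange.comp hq hgc
  refine Dense.mono ?_ hgq
  rintro _ ⟨p, rfl⟩
  refine ⟨(p.1 : E) + (p.2 : E) * ω, ?_⟩
  simp only [Function.comp_apply, map_add, map_mul, map_ratCast, Complex.ofReal_ratCast]

/-- `τ₀(E)³` is dense in `ℂ³`. -/
theorem denseRange_complexEmbedding_pi (τ₀ : E →+* ℂ) :
    DenseRange (fun e : Fin 3 → E => fun i => τ₀ (e i)) :=
  DenseRange.piMap (f := fun _ : Fin 3 => τ₀) fun _ => denseRange_complexEmbedding τ₀

end Density

section Form

variable {E : Type} [Field E] [NumberField E] [IsCMField E]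

/-- `τ₀ ⟪x, y⟫_H = star (τ₀ ∘ x) ⬝ᵥ (H.map τ₀ *ᵥ (τ₀ ∘ y))` for a complex embedding `τ₀` of the CM field `E`
(`c = complexConj E`, `τ₀ ∘ c = conj ∘ τ₀`) — the two-argument form of SeesawCarry's `map_hform_self`. -/
theorem map_hform (H : Matrix (Fin 3) (Fin 3) E) (τ₀ : E →+* ℂ) (x y : Fin 3 → E) :
    τ₀ (hform (IsCMField.complexConj E).toRingEquiv H x y) =
      star (fun i => τ₀ (x i)) ⬝ᵥ (H.map τ₀ *ᵥ fun i => τ₀ (y i)) := by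
  unfold hform
  rw [RingHom.map_dotProduct]
  have h1 : (τ₀ ∘ fun i => (IsCMField.complexConj E).toRingEquiv (x i)) = star (fun i => τ₀ (x i)) := by
    funext i
    simp only [Function.comp_apply, Pi.star_apply, AlgEquiv.coe_ringEquiv,
      IsCMField.complexEmbedding_complexConj, RCLike.star_def]
  have h2 : (τ₀ ∘ (H *ᵥ y)) = H.map τ₀ *ᵥ fun i => τ₀ (y i) := by
    funext i
    exact RingHom.map_mulVec τ₀ H y i
  rw [h1, h2]

/-- `H.map τ₀` is hermitian when `H` is `c`-hermitian (`c(H)ᵀ = H`, `τ₀ ∘ c = conj ∘ τ₀`). -/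
theorem isHermitian_map_of_isCHermitian (H : Matrix (Fin 3) (Fin 3) E)
    (hH : IsCHermitian (IsCMField.complexConj E).toRingEquiv H) (τ₀ : E →+* ℂ) : (H.map τ₀).IsHermitian := by
  have hHij : ∀ i j, IsCMField.complexConj E (H i j) = H j i := by
    intro i j
    have := congrFun (congrFun hH j) i
    simpa [cstar, Matrix.transpose_apply, Matrix.map_apply] using this
  ext i j
  rw [Matrix.conjTranspose_apply, Matrix.map_apply, Matrix.map_apply, ← hHij j i,
    IsCMField.complexEmbedding_complexConj]
  exact (starRingEnd_apply _).symm

end Form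

section FormAlgebra

/-- `⟪x, y − s•z⟫_H = ⟪x, y⟫_H − s·⟪x, z⟫_H`: `E`-linearity of `hform` in the second slot. -/
theorem hform_sub_smul {E : Type} [Field E] (c : E ≃+* E) (H : Matrix (Fin 3) (Fin 3) E) (x y z : Fin 3 → E)
    (s : E) : hform c H x (y - s • z) = hform c H x y - s * hform c H x z := by
  unfold hform
  rw [Matrix.mulVec_sub, Matrix.mulVec_smul, dotProduct_sub, dotProduct_smul, smul_eq_mul]

/-- Hermitian symmetry of the complex form: `star y ⬝ᵥ (M *ᵥ x) = conj (star x ⬝ᵥ (M *ᵥ y))` for `Mᴴ = M`. -/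
theorem star_dotProduct_mulVec_comm {M : Matrix (Fin 3) (Fin 3) ℂ} (hM : M.IsHermitian) (x y : Fin 3 → ℂ) :
    star y ⬝ᵥ (M *ᵥ x) = conj (star x ⬝ᵥ (M *ᵥ y)) := by
  calc star y ⬝ᵥ (M *ᵥ x) = star y ⬝ᵥ (Mᴴ *ᵥ x) := by rw [hM.eq]
    _ = (star y ᵥ* Mᴴ) ⬝ᵥ x := Matrix.dotProduct_mulVec _ _ _
    _ = star (M *ᵥ y) ⬝ᵥ star (star x) := by rw [Matrix.star_mulVec, star_star]
    _ = star (star x ⬝ᵥ (M *ᵥ y)) := star_dotProduct_star _ _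
    _ = conj (star x ⬝ᵥ (M *ᵥ y)) := rfl

/-- The complex form on `s•x + w`, expanded (hermitian `M`): `|s|²·φ(x,x) + conj s·φ(x,w) + s·conj φ(x,w) + φ(w,w)`. -/
theorem form_expand {M : Matrix (Fin 3) (Fin 3) ℂ} (hM : M.IsHermitian) (s : ℂ) (x w : Fin 3 → ℂ) :
    star (s • x + w) ⬝ᵥ (M *ᵥ (s • x + w)) =
      conj s * s * (star x ⬝ᵥ (M *ᵥ x)) + conj s * (star x ⬝ᵥ (M *ᵥ w)) +
        s * conj (star x ⬝ᵥ (M *ᵥ w)) + star w ⬝ᵥ (M *ᵥ w) := by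
  rw [← star_dotProduct_mulVec_comm hM]
  simp only [star_add, star_smul, Matrix.mulVec_add, Matrix.mulVec_smul, add_dotProduct, dotProduct_add,
    smul_dotProduct, dotProduct_smul, smul_eq_mul, starRingEnd_apply]
  ring

/-- The complex form pulled back along `C`: `star (C y) ⬝ᵥ (M (C y)) = star y ⬝ᵥ ((Cᴴ M C) y)`. -/
theorem form_mulVec_mulVec (M C : Matrix (Fin 3) (Fin 3) ℂ) (y : Fin 3 → ℂ) :
    star (C *ᵥ y) ⬝ᵥ (M *ᵥ (C *ᵥ y)) = star y ⬝ᵥ ((Cᴴ * M * C) *ᵥ y) := by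
  rw [Matrix.star_mulVec, Matrix.mulVec_mulVec, Matrix.dotProduct_mulVec, Matrix.vecMul_vecMul,
    ← Matrix.dotProduct_mulVec, Matrix.mul_assoc]

/-- A Sylvester matrix for `M` exhibits a `Re > 0` vector: `C e₀` (or `C e₂` in the `−J` case). -/
theorem exists_pos_of_isSylvester {M C : Matrix (Fin 3) (Fin 3) ℂ} (hC : IsSylvester M C) :
    ∃ u : Fin 3 → ℂ, 0 < (star u ⬝ᵥ (M *ᵥ u)).re := by
  rcases hC.2 with h | h
  · refine ⟨C *ᵥ ![1, 0, 0], ?_⟩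
    rw [form_mulVec_mulVec, h]
    simp [J, dotProduct, Matrix.mulVec, Fin.sum_univ_three, Matrix.diagonal]
  · refine ⟨C *ᵥ ![0, 0, 1], ?_⟩
    rw [form_mulVec_mulVec, h]
    simp [J, dotProduct, Matrix.mulVec, Fin.sum_univ_three, Matrix.diagonal]

/-- A Sylvester matrix for `M` exhibits a `Re < 0` vector: `C e₂` (or `C e₀` in the `−J` case). -/
theorem exists_neg_of_isSylvester {M C : Matrix (Fin 3) (Fin 3) ℂ} (hC : IsSylvester M C) :
    ∃ v : Fin 3 → ℂ, (star v ⬝ᵥ (M *ᵥ v)).re < 0 := by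
  rcases hC.2 with h | h
  · refine ⟨C *ᵥ ![0, 0, 1], ?_⟩
    rw [form_mulVec_mulVec, h]
    simp [J, dotProduct, Matrix.mulVec, Fin.sum_univ_three, Matrix.diagonal]
  · refine ⟨C *ᵥ ![1, 0, 0], ?_⟩
    rw [form_mulVec_mulVec, h]
    simp [J, dotProduct, Matrix.mulVec, Fin.sum_univ_three, Matrix.diagonal]

end FormAlgebra

section LinePair

variable {E : Type} [Field E] [NumberField E] [IsCMField E]

/-- **C-L4-LINE-PAIR**: from the target's own fields alone (`H` `c`-hermitian, a complex embedding `τ₀`, a Sylvester matrix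
`C` for `H.map τ₀`), there are two non-zero `H`-orthogonal lines `e₁, e₂` of `V = E³` with `Re τ₀⟪e₁,e₁⟫_H > 0` and
`Re τ₀⟪e₂,e₂⟫_H < 0` — the wall's `_ha` / `_hpos` at `i = 0, 2` for the dictionary `a 0 = ⟪e₁,e₁⟫_H`, `a 2 = −⟪e₂,e₂⟫_H`. -/
theorem exists_orthogonal_lines_of_sylvester (H : Matrix (Fin 3) (Fin 3) E)
    (hH : IsCHermitian (IsCMField.complexConj E).toRingEquiv H) (τ₀ : E →+* ℂ)
    (C : Matrix (Fin 3) (Fin 3) ℂ) (hC : IsSylvester (H.map τ₀) C) :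
    ∃ e₁ e₂ : Fin 3 → E, e₁ ≠ 0 ∧ e₂ ≠ 0 ∧
      hform (IsCMField.complexConj E).toRingEquiv H e₁ e₂ = 0 ∧
      0 < (τ₀ (hform (IsCMField.complexConj E).toRingEquiv H e₁ e₁)).re ∧
      (τ₀ (hform (IsCMField.complexConj E).toRingEquiv H e₂ e₂)).re < 0 := by
  obtain ⟨c, hc⟩ : ∃ c : E ≃+* E, c = (IsCMField.complexConj E).toRingEquiv := ⟨_, rfl⟩
  obtain ⟨M, hM⟩ : ∃ M : Matrix (Fin 3) (Fin 3) ℂ, M = H.map τ₀ := ⟨_, rfl⟩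
  rw [← hM] at hC
  rw [← hc]
  have hMh : M.IsHermitian := by rw [hM]; exact isHermitian_map_of_isCHermitian H hH τ₀
  -- the embedding `ι : E³ → ℂ³`
  obtain ⟨ι, hι⟩ : ∃ ι : (Fin 3 → E) → (Fin 3 → ℂ), ι = fun e i => τ₀ (e i) := ⟨_, rfl⟩
  have hιapply : ∀ (e : Fin 3 → E) (i : Fin 3), ι e i = τ₀ (e i) := by intro e i; rw [hι]
  have hdense : DenseRange ι := by rw [hι]; exact denseRange_complexEmbedding_pi τ₀
  have hmap : ∀ x y : Fin 3 → E, τ₀ (hform c H x y) = star (ι x) ⬝ᵥ (M *ᵥ ι y) := by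
    intro x y
    rw [hι, hc, hM]
    exact map_hform H τ₀ x y
  -- continuity of the quadratic form
  have hcont : Continuous fun x : Fin 3 → ℂ => star x ⬝ᵥ (M *ᵥ x) := by fun_prop
  -- a positive and a negative vector from the Sylvester matrix
  obtain ⟨u, hu⟩ := exists_pos_of_isSylvester hC
  obtain ⟨v, hv⟩ := exists_neg_of_isSylvester hC
  -- `e₁`: a `τ₀`-positive vector of `E³` (density)
  have hopen₁ : IsOpen {x : Fin 3 → ℂ | 0 < (star x ⬝ᵥ (M *ᵥ x)).re} :=
    isOpen_lt continuous_const (Complex.continuous_re.comp hcont)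
  obtain ⟨e₁, he₁⟩ := hdense.exists_mem_open hopen₁ ⟨u, hu⟩
  obtain ⟨x₁, hx₁⟩ : ∃ x₁ : Fin 3 → ℂ, x₁ = ι e₁ := ⟨_, rfl⟩
  rw [← hx₁] at he₁
  have hpos₁ : 0 < (star x₁ ⬝ᵥ (M *ᵥ x₁)).re := he₁
  have h1 : 0 < (τ₀ (hform c H e₁ e₁)).re := by rw [hmap, ← hx₁]; exact hpos₁
  have hne₁ : hform c H e₁ e₁ ≠ 0 := by
    intro h0
    rw [h0, map_zero, Complex.zero_re] at h1
    exact lt_irrefl _ h1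
  have hx₁ne : star x₁ ⬝ᵥ (M *ᵥ x₁) ≠ 0 := by
    intro h0
    rw [h0, Complex.zero_re] at hpos₁
    exact lt_irrefl _ hpos₁
  -- the projection off `x₁` onto its `M`-orthogonal complement
  obtain ⟨P, hP⟩ : ∃ P : (Fin 3 → ℂ) → (Fin 3 → ℂ),
      P = fun y => y - ((star x₁ ⬝ᵥ (M *ᵥ y)) / (star x₁ ⬝ᵥ (M *ᵥ x₁))) • x₁ := ⟨_, rfl⟩
  have hPcont : Continuous P := by rw [hP]; fun_prop
  have hPorth : ∀ y, star x₁ ⬝ᵥ (M *ᵥ P y) = 0 := by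
    intro y
    simp only [hP, Matrix.mulVec_sub, Matrix.mulVec_smul, dotProduct_sub, dotProduct_smul, smul_eq_mul]
    rw [div_mul_cancel₀ _ hx₁ne, sub_self]
  have hPapply : ∀ z, P z = z - ((star x₁ ⬝ᵥ (M *ᵥ z)) / (star x₁ ⬝ᵥ (M *ᵥ x₁))) • x₁ := by
    intro z
    rw [hP]
  have hPP : ∀ y, P (P y) = P y := by
    intro y
    rw [hPapply (P y), hPorth y, zero_div, zero_smul, sub_zero]
  -- Step D: the complement carries a negative vector
  have hD : (star (P v) ⬝ᵥ (M *ᵥ P v)).re < 0 := by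
    refine lt_of_not_ge fun hcon => ?_
    obtain ⟨s, hs⟩ : ∃ s : ℂ, s = (star x₁ ⬝ᵥ (M *ᵥ v)) / (star x₁ ⬝ᵥ (M *ᵥ x₁)) := ⟨_, rfl⟩
    have hv' : v = s • x₁ + P v := by
      rw [hP, hs]
      show v = _ • x₁ + (v - _ • x₁)
      abel
    have hexp := form_expand hMh s x₁ (P v)
    rw [hPorth v, mul_zero, map_zero, mul_zero, add_zero, add_zero, ← hv'] at hexp
    have hre : (star v ⬝ᵥ (M *ᵥ v)).re =
        Complex.normSq s * (star x₁ ⬝ᵥ (M *ᵥ x₁)).re + (star (P v) ⬝ᵥ (M *ᵥ P v)).re := by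
      rw [hexp, ← Complex.normSq_eq_conj_mul_self, Complex.add_re, Complex.re_ofReal_mul]
    have hnn : 0 ≤ Complex.normSq s * (star x₁ ⬝ᵥ (M *ᵥ x₁)).re :=
      mul_nonneg (Complex.normSq_nonneg s) hpos₁.le
    linarith
  -- Step E: approximate it inside the complement by a point of `P (ι E³)`
  have hopen₂ : IsOpen {y : Fin 3 → ℂ | (star (P y) ⬝ᵥ (M *ᵥ P y)).re < 0} :=
    isOpen_lt (Complex.continuous_re.comp (hcont.comp hPcont)) continuous_const
  obtain ⟨f, hf⟩ := hdense.exists_mem_open hopen₂ ⟨P v, by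
    show (star (P (P v)) ⬝ᵥ (M *ᵥ P (P v))).re < 0
    rw [hPP v]
    exact hD⟩
  have hf' : (star (P (ι f)) ⬝ᵥ (M *ᵥ P (ι f))).re < 0 := hf
  -- `e₂ := f − (⟪e₁,f⟫/⟪e₁,e₁⟫)•e₁` has `ι e₂ = P (ι f)`
  have hιe₂ : ι (f - (hform c H e₁ f / hform c H e₁ e₁) • e₁) = P (ι f) := by
    funext i
    simp only [hP, hιapply, Pi.sub_apply, Pi.smul_apply, smul_eq_mul, map_sub, map_mul, map_div₀, hmap, hx₁]
  have h2 : (τ₀ (hform c H (f - (hform c H e₁ f / hform c H e₁ e₁) • e₁)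
      (f - (hform c H e₁ f / hform c H e₁ e₁) • e₁))).re < 0 := by
    rw [hmap, hιe₂]
    exact hf'
  have hne₂ : hform c H (f - (hform c H e₁ f / hform c H e₁ e₁) • e₁)
      (f - (hform c H e₁ f / hform c H e₁ e₁) • e₁) ≠ 0 := by
    intro h0
    rw [h0, map_zero, Complex.zero_re] at h2
    exact lt_irrefl _ h2
  have horth : hform c H e₁ (f - (hform c H e₁ f / hform c H e₁ e₁) • e₁) = 0 := by
    rw [hform_sub_smul, div_mul_cancel₀ _ hne₁, sub_self]
  exact ⟨e₁, f - (hform c H e₁ f / hform c H e₁ e₁) • e₁, ne_zero_of_hform_self_ne_zero c H hne₁,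
    ne_zero_of_hform_self_ne_zero c H hne₂, horth, h1, h2⟩

end LinePair

end Summit.Ventures.HodgeRepro.Tier4.Line4

end
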